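import Summits.AtomisticToContinuum.HydrodynamicLimit.Theorems.CollisionIsometryCLTAdaptedWeightCLTTimeLocal

/-!
# The collision-count input of the past-damping stub — line `contact-source-duhamel`, crux `AdaptedWeightCLT`
(stmt-AtomisticToContinuum-14868, rev-12 time-local form; route `CollisionIsometryCLT`, sub-problem
`HydrodynamicLimit`; definitions only, `--supports`)

Wave 1 of the line returned `stub-misstated: stub_pastDamping` (worker evidence `PastDampingMisstated.lean` on
the item; the standing disprover's `cradle_relay`, `Theorems/AdaptedWeightCLT/Negative/StubPastDampingCloudRelay.lean`,
is the same gap seen from the cloud side): the column-depolarisation hypothesis `CDAlongAt` controls COLUMN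
sums of the incoherent transport while PAST pairs ROW-weighted sums; they agree only if the impulse clouds
stay within `o(N^{-γ})` of their source in space, and besides free flights every fold step hands a `P`-part
over across the contact distance `ε_N = σ(N+1)^{-1/3}` in full (however gentle the collision: Newton's
cradle), so `∫ₓ PAST²` carries a transport term `≲ N^{γ} ε_N (N+1)⁻¹ #steps` that only a bound on the number of
fold steps along the flow can make small. Nothing typed so far bounds collision counts along the
non-equilibrium local-Gibbs flow; the predicate below is that input, the extra hypothesis of the re-cut
`stub_pastDamping : … → CDAlongAt σ a₀ θ₀ u₀ Φ → ∀ t > 0, TailsOn … t → FewStepsOn … t → PastSmallOn … t`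
(physically `∫₀ᵗ #steps ds ≍ t (N+1) σ² √θ log N ≪ (N+1)^{19/15}`; a provider may prefer the equivalent
phrasing "the orbit has `≤ δ (N+1)^{4/3+4/15}/log(N+2)` collisions in `[0,t]` with probability `→ 1`").
It lives in its own small module (not appended to `…TimeLocal.lean`) so that the sixteen modules importing
the time-local vocabulary are not rebuilt.
-/

namespace Summit.AtomisticToContinuum.HydrodynamicLimit.Theorems.ContactSourceDuhamel.TimeLocal

open scoped BigOperators Topology Classical MeasureTheory ENNReal InnerProductSpace
open Filter Set MeasureTheory

noncomputable section

/-- FEW FOLD STEPS on the horizon `[0, t]` at `(σ, profiles, Φ)` — the per-horizon collision-count input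
of `stub_pastDamping` (re-cut): `(N+1)^{-(1 + 4/15)} ∫₀ᵗ #steps[s − winLen N s, s] ds → 0` in local-Gibbs
probability, written junk-free with a lower Lebesgue integral (`steps σ N (winStart …) (winLen N s)` = the
number of fold steps of the line window at time `s`, the quantity `PastSq` transports through). Nothing is
asserted here. -/
def FewStepsOn (σ : ℝ) (a₀ θ₀ : T3 → ℝ) (u₀ : T3 → V3) (Φ : Flows σ) (t : ℝ) : Prop :=
  ∀ δ : ℝ, 0 < δ → Tendsto (fun N : ℕ => Literature.MathematicalPhysics.KineticTheory.localGibbsLaw σ a₀ u₀ θ₀ N (Φ N) {z | ENNReal.ofReal (δ * ((N + 1 : ℕ) : ℝ) ^ ((19 : ℝ) / 15)) < ∫⁻ s in Icc 0 t, (steps σ N (winStart σ N (Φ N) s z) (winLen N s) : ℝ≥0∞)}) atTop (𝓝 0)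

/-- Unfolding of `FewStepsOn` (anchor of this definitions file). -/
theorem fewStepsOn_iff : ∀ (σ : ℝ) (a₀ θ₀ : T3 → ℝ) (u₀ : T3 → V3) (Φ : Flows σ) (t : ℝ), FewStepsOn σ a₀ θ₀ u₀ Φ t ↔ ∀ δ : ℝ, 0 < δ → Tendsto (fun N : ℕ => Literature.MathematicalPhysics.KineticTheory.localGibbsLaw σ a₀ u₀ θ₀ N (Φ N) {z | ENNReal.ofReal (δ * ((N + 1 : ℕ) : ℝ) ^ ((19 : ℝ) / 15)) < ∫⁻ s in Icc 0 t, (steps σ N (winStart σ N (Φ N) s z) (winLen N s) : ℝ≥0∞)}) atTop (𝓝 0) :=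
  fun _ _ _ _ _ _ => Iff.rfl

end

end Summit.AtomisticToContinuum.HydrodynamicLimit.Theorems.ContactSourceDuhamel.TimeLocal
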